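/-
Copyright (c) 2026. All rights reserved.
Released under Apache 2.0 license as described in the file LICENSE.
Authors: abc-iut cell, statement-typer seat abc-iut-L4-t3 (wave 1; gen 8).
-/
import Literature.AnabelianGeometry.AbsoluteAnabelian.Ltimes.LogFrobeniusIotaEtaSquare
import Literature.AnabelianGeometry.AbsoluteAnabelian.Ltimes.LogFrobeniusMonoTelecoreContact
import Literature.AnabelianGeometry.AbsoluteAnabelian.LogFrobeniusMonoTelecorePinnedIota
import HarnessLib

/-!
# [AbsTopIII] Corollary 5.10 (iv)(b)(c), print-faithful pinned reading WITH the `ι^{An⊢⊞}`-generators (the statement `F-0139″`)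

S. Mochizuki, *Topics in absolute anabelian geometry III: global reconstruction algorithms*,
J. Math. Sci. Univ. Tokyo 22 (2015) 939–1156 [MochizukiAbsTopIII2015]; locators `p.N` = pages of the author's
manuscript (`paper:url-5493eb38cbb7`), read on the page: Cor 5.10 (iv)(b) p. 147 l. 54 – p. 148 l. 8 (the telecore
`𝔗_{An⊢}` with telecore edges `φ^{An⊢⊞}_{v,ν}`), (iv)(c) p. 148 l. 9–51 ("there is a natural isomorphism `η⊢_{v,ν}` from the
composite functor determined by the path `γ¹_{v,ν}` … to the composite functor determined by the path `γ⁰_{v,ν}` …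
Moreover, the resulting homotopies `η⊢_{v,ν}`, `(η⊢_{v,ν})⁻¹`, together with the mono-analyticization homotopies and **the
homotopies on `D_{An⊢}` arising from the `ι^{An⊢⊞}_{v,ε}`** [cf. Proposition 5.8, (vii)], **generate** a contact structure
`ℋ_{An⊢}` on `𝔗_{An⊢}` that is compatible with …"); Prop 5.8 (vii) p. 142 (`ι^{An⊢⊞}_{w,ε} : ψ^{An⊢⊞}_{w,ν₁} → ψ^{An⊢⊞}_{w,ν₂}` for
each edge `ε` of `Γ⃗×_w`); Def 3.5 (ii)/(iv) pp. 75–76.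

WHY THIS FILE (successor statement of this lineage's `Cor510MonoTelecorePinned` — FACT-LIST F-0139′ —, never re-meant
in place; L4-lead GO «F-0139″-STATEMENT», scoped).  The pinned row places, in a contact structure `ℋ_{An⊢}` on SOME telecore
with the printed edges, the pairs `(γ¹_{v,ν}, γ⁰_{v,ν})` in both orders — and nothing else of print's list of generators.
This file types the bold clause: over the add-on data that abc-iut-f-101 proved NECESSARY and SUFFICIENT for the pinned row
(`M` = mono-analyticization homotopies, `K` = "`ψ` over `ℰ⊢`" + the printed `η⊢_{v,ν}` + its coherence) and this lineage's
`ι^{An⊢⊞}`-data `I` over `K`,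

* `Cor510MonoTelecorePinnedIota L` := `∃ M K (I : K.IotaData)`, (1) `K.EtaNatural I` — the edge-indexed coherence datum of
  print's single family (`LogFrobeniusIotaEtaSquare`: forced by Def 3.5 (ii)'s one-homotopy-per-pair; independent of the
  interface, `…Independence`; holds at the genuine carrier, `…GenuineOpen`); (2) a contact structure `Hc` on THE
  telecore `𝔗_{An⊢}` built over `(M, K)` (abc-iut-f-101's `MonoTelecoreCoherence.monoTelecore`: telecore edges the printed
  `φ^{An⊢⊞}_{v,ν}` ON THE NOSE, so every pinned edge computes) containing the printed pairs `(γ¹_{v,ν}, γ⁰_{v,ν})` in both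
  orders (abc-iut-f-101's paths `gammaOne`, `gammaZero`) AND, for every edge `ε : ν₁ → ν₂` of `Γ⃗×_v`, **the pair
  `([φ^{An⊢⊞}_{v,ν₁}], [φ^{An⊢⊞}_{v,ν₂}])` with homotopy `ι^{An⊢⊞}_{v,ε}`** (pinned to `I.ι` up to the cast of path functors, `HEq`);
* `Cor510MonoTelecorePinnedIota.cor510MonoTelecorePinned` — it refines the pinned row (via abc-iut-f-101's sufficiency
  from `K`); `….etaNatural` — it carries the edge coherence by construction; `….telPath_refl_mem` — the telecore edges
  become boundary paths of `ℋ_{An⊢}`.  Honest bookkeeping: the `ι`-pairs are ONE-WAY (print's `ι^{An⊢⊞}` are not invertible: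
  inclusions `𝒪^× ↪ k̄^×`, torsion quotients), so `Hc` is not asked to contain the swapped pair — unlike the `η⊢`-pairs.

NOT HERE (scoped out by the L4-lead): the observable pairs of `S_log`, `S_log⊞` in one family with `ℋ_{An⊢}` — that is
abc-iut-w5-d144's `Cor510MonoContactObservablesCompatible` (`LogFrobeniusMonoTelecoreObservables.lean`), to be CONJOINED by
name, never restated; the compatibility with `𝔗_{An•}`, `ℋ_{An•}`; "generate" as `IsGeneratedBy` (membership only, as in the
pinned row — TODO(general form)).  NO INSTANCE YET (honest): abc-iut-f-101's genuine contact structure `monoContact`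
relates only paths within one class `A_ν` by ISOMORPHISMS; the `ι`-pairs join two classes by a non-invertible homotopy, so
a closer at the genuine open-augmentation carrier needs the relative family EXTENDED by the `ι`-generators (with
`EtaNatural` and the `ι^{An⊢⊞}`-square of Def 5.4 (iii) as its coherence laws) — the successor row «F-0139″-CLOSER».  A
statement about the interface `L` (an ASSUMPTION the text asserts for the genuine theaters); refereed pre-IUT material;
nothing here bears on [IUTchIII] Cor. 3.12; OUR kernel typing, no side taken; typed ≠ proved.

**`⋉`-TWIN (cell row «LTIMES-SUCCESSOR», L4-lead m162; typing finding T3g9-F1).**  This file is the verbatim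
re-elaboration of `LogFrobeniusMonoTelecorePinnedIota.lean` over the successor interface `LogFrobeniusSettingLtimes`
(`Ltimes/LogFrobeniusCompatibility.lean`: `ι⊞_{v,ε}` indexed by the edges of `Γ⃗^⋉_v` at EVERY place, [AbsTopIII] Cor 5.5 (iii)
p. 131), produced by the cell recipe `LTIMES-RECIPE.md`: names carry over inside `namespace LogFrobeniusSettingLtimes`, the
section variable is `Lt`, setting-independent declarations are NOT repeated (the originals are in scope), statements and
proofs are otherwise unchanged.  The original file over the frozen interface stays as it is.
-/

set_option autoImplicit false

universe u

open CategoryTheory Quiver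

namespace Literature.AnabelianGeometry.AbsoluteAnabelian

namespace LogFrobeniusSettingLtimes

variable {Vmod : Type u} {isArc : Vmod → Bool} (Lt : LogFrobeniusSettingLtimes Vmod isArc)

/-- the telecore edge `[φ^{An⊢⊞}_{v,ν}]` of `D_{An⊢}` as a path of length one out of the core vertex `An⊢[𝒩⊢⊞]` (the domain and
codomain paths of "the homotopies on `D_{An⊢}` arising from the `ι^{An⊢⊞}_{v,ε}`").
[cite: MochizukiAbsTopIII2015, Cor 5.10 (iv)(c) p. 148] -/
def telPath (v : Vmod) (ν : LogVertex (isArc v)) (hν : ν.IsCross) :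
    Path (coreVx Vmod isArc) (nmonoPlusVx (isArc := isArc) v) :=
  Path.nil.cons (telE v ν hν)

/-- **[AbsTopIII] Cor 5.10 (iv)(b)(c), pinned, WITH the `ι^{An⊢⊞}`-generators (`F-0139″`)** — for `V(F_mod) ≠ ∅`: there are
mono-analyticization homotopies `M`, a coherence datum `K` (`ψ` over `ℰ⊢`, the printed `η⊢_{v,ν}`, `η⊢` over `ℰ⊢`) and
`ι^{An⊢⊞}`-data `I` over it such that (1) the `η⊢`-naturality square `K.EtaNatural I` holds along every edge of every `Γ⃗×_v`, and
(2) THE telecore `𝔗_{An⊢}` over `(M, K)` (edges the printed `φ^{An⊢⊞}_{v,ν}`) carries a contact structure `ℋ_{An⊢}` containing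
the printed pairs `(γ¹_{v,ν}, γ⁰_{v,ν})` in both orders and, for every edge `ε : ν₁ → ν₂` of `Γ⃗×_v`, the pair
`([φ^{An⊢⊞}_{v,ν₁}], [φ^{An⊢⊞}_{v,ν₂}])` whose homotopy IS `ι^{An⊢⊞}_{v,ε}`. [cite: MochizukiAbsTopIII2015, Cor 5.10 (iv)(c) p. 148] -/
def Cor510MonoTelecorePinnedIota [Nonempty Vmod] : Prop :=
  ∃ (M : Lt.MonoAnalyticizationHomotopies) (Kt : Lt.MonoTelecoreCoherence M) (Ia : Kt.IotaData),
    Kt.EtaNatural Ia ∧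
      ∃ Hc : Lt.monoTeleDiagram.HomotopyFamily,
        DiagramOfCategories.Telecore.IsContactStructure _ Kt.monoTelecore Hc ∧
          (∀ (v : Vmod) (ν : LogVertex (isArc v)) (hν : ν.IsCross),
            Hc.E (gammaOne v ν hν) (gammaZero v ν hν) ∧ Hc.E (gammaZero v ν hν) (gammaOne v ν hν)) ∧
          ∀ (v : Vmod) ⦃ν₁ ν₂ : LogVertex (isArc v)⦄ (ε : LogEdgeTS (isArc v) ν₁ ν₂) (hε : ε.InCore),
            ∃ h : Hc.E (telPath v ν₁ hε.isCross_src) (telPath v ν₂ hε.isCross_tgt), HEq (Hc.η h) (Ia.ι v ε hε)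

namespace Cor510MonoTelecorePinnedIota

variable {Lt}

/-- `F-0139″` refines the pinned row `F-0139′` (abc-iut-f-101: the data `(M, K)` alone yield `Cor510MonoTelecorePinned`).
[cite: MochizukiAbsTopIII2015, Cor 5.10 (iv)(b)(c) pp. 147–148] -/
theorem cor510MonoTelecorePinned [Nonempty Vmod] (h : Lt.Cor510MonoTelecorePinnedIota) : Lt.Cor510MonoTelecorePinned := by
  obtain ⟨M, Kt, -, -, -⟩ := h
  exact Kt.cor510MonoTelecorePinned

/-- `F-0139″` carries the `η⊢`-naturality square by construction (clause (1)): the data half lands in `EtaNatural`.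
[cite: MochizukiAbsTopIII2015, Cor 5.10 (iv)(c) p. 148] -/
theorem etaNatural [Nonempty Vmod] (h : Lt.Cor510MonoTelecorePinnedIota) :
    ∃ (M : Lt.MonoAnalyticizationHomotopies) (Kt : Lt.MonoTelecoreCoherence M) (Ia : Kt.IotaData), Kt.EtaNatural Ia := by
  obtain ⟨M, Kt, Ia, hI, -⟩ := h
  exact ⟨M, Kt, Ia, hI⟩

/-- `F-0139″` places, for every vertex `ν` of `Γ⃗×_v`, the telecore edge `[φ^{An⊢⊞}_{v,ν}]` among the boundary paths of `ℋ_{An⊢}`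
whenever `ν` has an edge of `Γ⃗×_v` out of it (Def 3.5 (ii) (a): the diagonal of a boundary pair is a boundary pair).
[cite: MochizukiAbsTopIII2015, Definition 3.5 (ii) p. 75] -/
theorem telPath_refl_mem [Nonempty Vmod] (h : Lt.Cor510MonoTelecorePinnedIota) (v : Vmod) {ν₁ ν₂ : LogVertex (isArc v)}
    (ε : LogEdgeTS (isArc v) ν₁ ν₂) (hε : ε.InCore) :
    ∃ (M : Lt.MonoAnalyticizationHomotopies) (Kt : Lt.MonoTelecoreCoherence M) (Hc : Lt.monoTeleDiagram.HomotopyFamily),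
      DiagramOfCategories.Telecore.IsContactStructure _ Kt.monoTelecore Hc ∧
        Hc.E (telPath v ν₁ hε.isCross_src) (telPath v ν₁ hε.isCross_src) ∧
          Hc.E (telPath v ν₂ hε.isCross_tgt) (telPath v ν₂ hε.isCross_tgt) := by
  obtain ⟨M, Kt, Ia, -, Hc, hcs, -, hι⟩ := h
  obtain ⟨hmem, -⟩ := hι v ε hε
  exact ⟨M, Kt, Hc, hcs, Hc.isSaturated.refl_left hmem, Hc.isSaturated.refl_right hmem⟩

end Cor510MonoTelecorePinnedIota

end LogFrobeniusSettingLtimes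

end Literature.AnabelianGeometry.AbsoluteAnabelian
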